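import Literature.Computability.Complexity.PaulPippengerSzemerediTrotter1983Clocks
import Literature.Computability.Complexity.MapFstMachine
import Literature.Computability.Complexity.TruncMapMachine
import Literature.Computability.Complexity.Williams2014Transfer
import HarnessLib

/-!
# Linear padding: `NTIME(n) ⊆ DTIME(n) ⟹ NTIME(g) ⊆ DTIME(g)` (the translation step of PPST 1983)

Literature / complexity toolkit, third brick of the inline formalization of the shell (§4) of
Paul–Pippenger–Szemerédi–Trotter 1983 (`PaulPippengerSzemerediTrotter1983.lean`, fact
`PaulEtAl1983_NTIME_not_subset_DTIME`). Besides the speed-up and the collapse lemma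
(`…Collapse.lean`), the printed argument translates the hypothesis `NTIME(n) ⊆ DTIME(n)` to a
superlinear level `t` by PADDING (Santhanam 2001, §2, p. 3, on [24] = PPST: "A collapse lemma is
then used to prove that, if `DTIME(n) = NTIME(n)`, then `DTIME(t) = Σ₄(t)` for any
time-constructible `t`"; Arora–Barak 2009, §2.6.2 "translating upward", proof of Thm. 2.22).
Over the tree's classes (`DTIME`, and the one-constant verifier form of `NTIME`,
`Nondeterministic.lean`) this is a genuine machine construction, as every padding in the tree is
(`ExpPadding.lean`, `NTIMEPadding.lean`), with one new difficulty: at the LINEAR level the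
validity of a pad `⟨x, 1^{g|x|}⟩` must be decided in time linear in the length of the word, also
on invalid words `⟨x, u⟩` with `|u| ≪ g|x|`, where producing `1^{g|x|}` is unaffordable. It is
decided on NUMERALS instead — `bin |u|` by the linear counter of `…Clocks.lean`, `bin (g|x|)` by
the hypothesis that `1ⁿ ↦ bin (g n)` runs in LINEAR time (true for `n log* n`, `n log n`, `nᵏ`,
`2ⁿ`, and all PPST needs) — which is why that hypothesis, slightly stronger than
`IsTimeConstructible g`, appears below.

* Stack programs (`Com`, `StackPrograms.lean`, compiled by `Com.outputsWithin_of_runs_equiv`):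
  the pair reader `Com.prs` (`(boolUnpair z).1`, `readRest z` of `PairFstTM` as a program,
  `Com.runs_prs`), flags `Com.markBad`, the all-units test `Com.onesChk`, the lockstep equality
  test `Com.eqChk` (`Com.mismatch`, `Com.mismatch_or_drop`); the tagging program
  `PadLin.tagProg : z ↦ ⟨1^{|x|}, z⟩` (`PadLin.runs_tagProg`, `16|z| + 10`) and the un-padding
  core `PadLin.unpadProg` (`PadLin.unpadCore`, `PadLin.runs_unpadProg`, `59|w| + 20`), with their
  machines `PadLin.exists_tag_machine`, `PadLin.exists_unpadCore_machine`;
* `unpadLin g z` (valid pads `⟨x, 1^{g|x|}⟩ ↦ x`, everything else `↦ ε`, the convention of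
  `polyUnpad`), `padLin g L = (unpadLin g)⁻¹ L`, `unpadLin_pad`, `pad_mem_padLin`,
  `apply_length_unpadLin_le` (`g |unpadLin g z| ≤ |z| + g 0`: the level of the payload is paid
  for by the word);
* `isTimeConstructible_of_linear_binary`; **`exists_unpadLin_machine`** — `z ↦ unpadLin g z` in
  linear time: tag, compute `bin (g|x|)` on the tag with `z` parked (`mapFstAux`,
  `MapFstMachine.lean`), run the core; `exists_unpad_clock_machine` (un-pad, then the witness
  clock `x' ↦ ⟨x', 1^{c g|x'| + c}⟩`, `exists_unaryClock_of_timeConstructible`);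
* **`padLin_mem_NTIME_id`**: `L ∈ NTIME(g) → padLin g L ∈ NTIME(n)` (verifier
  `truncMapAux (un-pad-and-clock) ⨟ V`: cut the witness at the admissible length of the given
  verifier `V`, then run `V`; the device of `NTIME_mono_holds` / `padPre_mem_NTIME_two_pow`);
* **`mem_DTIME_of_padLin_mem_DTIME_id`**: `padLin g L ∈ DTIME(n) → L ∈ DTIME(g)` for
  time-constructible `g` (pad by the unary clock, then decide);
* **`NTIME_subset_DTIME_of_linear_collapse`**: for `g ≥ id` with `1ⁿ ↦ bin (g n)` in linear
  time, `NTIME(n) ⊆ DTIME(n) → NTIME(g) ⊆ DTIME(g)`.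

No named fact is introduced (definitions with bodies and theorems only).

## References

* W. J. Paul, N. Pippenger, E. Szemerédi, W. T. Trotter, *On determinism versus non-determinism
  and related problems*, FOCS 1983, 429–438, §4 [PaulEtAl1983].
* R. Santhanam, *On separators, segregators and time versus space*, CCC 2001, §2 (p. 3: the
  collapse-and-translate step of [24]; Lemma 2.3) [Santhanam2001].
* S. Arora, B. Barak, *Computational Complexity: A Modern Approach*, CUP 2009, §2.6.2 and
  Thm. 2.22 (padding, "translating upward"), Def. 2.1 / Thm. 2.6 (verifier form: the verifier
  ignores the part of the certificate it does not need), §1.3 (time-constructible functions)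
  [AroraBarakCC2009].
* T. Nipkow, G. Klein, *Concrete Semantics with Isabelle/HOL*, Springer 2014, Ch. 7–8 (big-step
  cost semantics; the verification style of `StackPrograms.lean`).
-/

namespace Literature.Computability.Complexity

open _root_.Computability Turing PairFstTM

namespace Com

section Generic

variable {ι : Type} [DecidableEq ι]

/-! ### The pair reader as a stack program -/

/-- `prs src dst tmp`: read `src` two symbols at a time; an equal pair `bb` is a doubled bit of
the first component, pushed on `dst`; the first unequal pair ends the first component and the
rest of `src` is poured (reversed) onto `tmp`; an incomplete pair is dropped. This is the pair
reader of `PairFstTM` / `MapFstTM` (`(boolUnpair z).1`, `readRest z`) as a `Com` program.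
[folklore] -/
def prs (src dst tmp : ι) : Com ι :=
  loop src (pop src (push dst true) (pour src tmp) skip) (pop src (pour src tmp) (push dst false) skip)

/-- **Effect of the pair reader** on `src = z` (cost `≤ 3|z| + 4`): `src` emptied, the bits of
`(boolUnpair z).1` pushed on `dst` (so reversed), `readRest z` poured on `tmp` (so reversed).
[folklore] -/
theorem runs_prs {src dst tmp : ι} (hsd : src ≠ dst) (hst : src ≠ tmp) (hdt : dst ≠ tmp) :
    ∀ (z : List Bool) (R : Regs ι), R src = z → R tmp = [] →
      Runs (prs src dst tmp) R
        (Function.update (Function.update (Function.update R src []) dst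
          ((boolUnpair z).1.reverse ++ R dst)) tmp (readRest z).reverse)
        (3 * z.length + 4)
  | [], R, hz, ht => by
    refine (Runs.loop_nil _ _ hz).of_eq ?_ (by simp)
    ext i : 1
    simp only [Function.update_apply, boolUnpair, readRest, List.reverse_nil, List.nil_append]
    split_ifs <;> simp_all
  | [b], R, hz, ht => by
    have hbody : ∀ (ct cf : Com ι), Runs (pop src ct cf skip) (Function.update R src [])
        (Function.update R src []) 2 := fun ct cf =>
      Runs.pop_nil _ _ (by simp) (Runs.skip _)
    have hrest : Runs (prs src dst tmp) (Function.update R src []) (Function.update R src []) 1 :=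
      Runs.loop_nil _ _ (by simp)
    have e : Function.update R src [] = Function.update (Function.update (Function.update R src [])
        dst ((boolUnpair [b]).1.reverse ++ R dst)) tmp (readRest [b]).reverse := by
      ext i : 1
      simp only [Function.update_apply, boolUnpair, readRest, List.reverse_nil, List.nil_append]
      split_ifs <;> simp_all
    cases b
    · exact (Runs.loop_false (w := []) hz (hbody _ _) hrest).of_eq e (by simp)
    · exact (Runs.loop_true (w := []) hz (hbody _ _) hrest).of_eq e (by simp)
  | b :: b' :: rest, R, hz, ht => by
    by_cases hbb : b = b'
    · -- a doubled bit: push it and go on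
      subst hbb
      set R₁ := Function.update (Function.update R src rest) dst (b :: R dst) with hR₁
      have ih := runs_prs hsd hst hdt rest R₁ (by simp [hR₁, Function.update_of_ne hsd])
        (by simp [hR₁, Function.update_of_ne hdt.symm, Function.update_of_ne hst.symm, ht])
      have e : Function.update (Function.update (Function.update R₁ src []) dst
            ((boolUnpair rest).1.reverse ++ R₁ dst)) tmp (readRest rest).reverse =
          Function.update (Function.update (Function.update R src []) dst
            ((boolUnpair (b :: b :: rest)).1.reverse ++ R dst)) tmp
            (readRest (b :: b :: rest)).reverse := by
        ext i : 1
        simp only [hR₁, Function.update_apply, boolUnpair_fst_cons_cons, if_true, readRest,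
          List.reverse_cons, List.append_assoc, List.singleton_append]
        split_ifs <;> simp_all
      have hpush : ∀ c : Bool, Runs (push dst c) (Function.update (Function.update R src (c :: rest))
          src rest) (Function.update (Function.update R src rest) dst (c :: R dst)) 1 := fun c =>
        (Runs.push dst c _).of_eq (by simp [Function.update_of_ne hsd.symm]) le_rfl
      cases b
      · have hbody : Runs (pop src (pour src tmp) (push dst false) skip)
            (Function.update R src (false :: rest)) R₁ (1 + 2) :=
          Runs.pop_false _ _ (w := rest) (by simp) (hpush false)
        refine (Runs.loop_false (w := false :: rest) hz hbody ih).of_eq e ?_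
        simp; omega
      · have hbody : Runs (pop src (push dst true) (pour src tmp) skip)
            (Function.update R src (true :: rest)) R₁ (1 + 2) :=
          Runs.pop_true _ _ (w := rest) (by simp) (hpush true)
        refine (Runs.loop_true (w := true :: rest) hz hbody ih).of_eq e ?_
        simp; omega
    · -- the separator (or junk): pour the rest away
      have hpour := runs_pour (a := src) (b := tmp) hst (Function.update R src rest)
      simp only [Function.update_self, Function.update_idem, Function.update_of_ne hst.symm,
        ht, List.append_nil] at hpour
      set R₁ := Function.update (Function.update R src []) tmp rest.reverse with hR₁
      have hrest : Runs (prs src dst tmp) R₁ R₁ 1 :=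
        Runs.loop_nil _ _ (by simp [hR₁, Function.update_of_ne hst])
      have e : R₁ = Function.update (Function.update (Function.update R src []) dst
            ((boolUnpair (b :: b' :: rest)).1.reverse ++ R dst)) tmp
            (readRest (b :: b' :: rest)).reverse := by
        ext i : 1
        simp only [hR₁, Function.update_apply, boolUnpair_fst_cons_cons, if_neg hbb, readRest,
          List.reverse_nil, List.nil_append]
        split_ifs <;> simp_all
      have hpop : ∀ c : Bool, Function.update (Function.update R src (c :: rest)) src rest =
          Function.update R src rest := fun c => by simp
      cases b <;> cases b' <;> simp at hbb
      · have hb : Runs (pop src (pour src tmp) (push dst false) skip)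
            (Function.update R src (true :: rest)) R₁ (3 * rest.length + 1 + 2) :=
          Runs.pop_true _ _ (w := rest) (by simp) (by rw [hpop]; exact hpour)
        exact (Runs.loop_false (w := true :: rest) hz hb hrest).of_eq e (by simp; omega)
      · have hb : Runs (pop src (push dst true) (pour src tmp) skip)
            (Function.update R src (false :: rest)) R₁ (3 * rest.length + 1 + 2) :=
          Runs.pop_false _ _ (w := rest) (by simp) (by rw [hpop]; exact hpour)
        exact (Runs.loop_true (w := false :: rest) hz hb hrest).of_eq e (by simp; omega)

/-! ### Flags, the all-ones test, numeral equality -/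

/-- `markBad g`: set the flag register `g` to exactly `[true]`. [folklore] -/
def markBad (g : ι) : Com ι := clear g ;; push g true

/-- `markBad g` costs `≤ 2|g| + 2`. [folklore] -/
theorem runs_markBad (g : ι) (R : Regs ι) :
    Runs (markBad g) R (Function.update R g [true]) (2 * (R g).length + 2) := by
  refine ((runs_clear g R).seq (Runs.push g true _)).of_eq ?_ (by omega)
  simp

/-- On a flag register (`flag c`, at most one symbol) `markBad` costs `≤ 4`. [folklore] -/
theorem runs_markBad_flag {g : ι} (R : Regs ι) (c : Bool) (hg : R g = flag c) :
    Runs (markBad g) R (Function.update R g [true]) 4 := by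
  refine (runs_markBad g R).mono ?_
  rw [hg]; cases c <;> simp

/-- `onesChk src dst g`: move `src` onto `dst` as units (`true`s), setting the flag `g` if some
symbol of `src` is `false`. [folklore] -/
def onesChk (src dst g : ι) : Com ι := loop src (push dst true) (push dst true ;; markBad g)

/-- **Effect of the all-ones test** on `src = w`, a flag `g ∈ {ε, [true]}` (cost `≤ 7|w| + 1`):
`src` emptied, `dst` gains `|w|` units, and `g = [true]` iff it was or `w` has a `false`.
[folklore] -/
theorem runs_onesChk {src dst g : ι} (hsd : src ≠ dst) (hsg : src ≠ g) (hdg : dst ≠ g) :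
    ∀ (w : List Bool) (R : Regs ι) (c : Bool), R src = w → R g = flag c →
      Runs (onesChk src dst g) R
        (Function.update (Function.update (Function.update R src []) dst
          (List.replicate w.length true ++ R dst)) g (flag (c || !(w.all id))))
        (7 * w.length + 1)
  | [], R, c, hw, hg => by
    refine (Runs.loop_nil _ _ hw).of_eq ?_ (by simp)
    ext i : 1
    simp only [Function.update_apply]
    split_ifs <;> simp_all
  | b :: w, R, c, hw, hg => by
    cases b
    · -- a `false`: push a unit and set the flag
      set R₁ := Function.update (Function.update (Function.update R src w) dst (true :: R dst)) g
        [true] with hR₁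
      have hbody : Runs (push dst true ;; markBad g) (Function.update R src w) R₁ (1 + 4) := by
        refine ((Runs.push dst true _).seq (runs_markBad_flag _ c ?_)).of_eq ?_ le_rfl
        · rw [Function.update_of_ne hdg.symm, Function.update_of_ne hsg.symm, hg]
        · simp [hR₁, Function.update_of_ne hsd.symm]
      have ih := runs_onesChk hsd hsg hdg w R₁ true (by simp [hR₁, Function.update_of_ne hsd,
        Function.update_of_ne hsg]) (by simp [hR₁])
      refine (Runs.loop_false (w := w) hw hbody ih).of_eq ?_ (by simp; omega)
      ext i : 1
      simp only [hR₁, Function.update_apply, List.length_cons, List.replicate_succ',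
        List.append_assoc, List.singleton_append, List.all_cons]
      split_ifs <;> simp_all
    · -- a `true`: push a unit
      set R₁ := Function.update (Function.update R src w) dst (true :: R dst) with hR₁
      have hbody : Runs (push dst true) (Function.update R src w) R₁ 1 :=
        (Runs.push dst true _).of_eq (by simp [hR₁, Function.update_of_ne hsd.symm]) le_rfl
      have ih := runs_onesChk hsd hsg hdg w R₁ c (by simp [hR₁, Function.update_of_ne hsd])
        (by simp [hR₁, Function.update_of_ne hdg.symm, Function.update_of_ne hsg.symm, hg])
      refine (Runs.loop_true (w := w) hw hbody ih).of_eq ?_ (by simp; omega)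
      ext i : 1
      simp only [hR₁, Function.update_apply, List.length_cons, List.replicate_succ',
        List.append_assoc, List.singleton_append, List.all_cons, id]
      split_ifs <;> simp_all

/-- The mismatch detector of the lockstep comparison: `true` iff, reading `p` against `q`
symbol by symbol, some position of `p` meets a different symbol or the end of `q`. [folklore] -/
def mismatch : List Bool → List Bool → Bool
  | [], _ => false
  | _ :: _, [] => true
  | d :: p, d' :: q => (!decide (d = d')) || mismatch p q

omit [DecidableEq ι] in
/-- The lockstep comparison followed by the emptiness test of the rest of `q` decides
equality: `(mismatch p q || !(q.drop |p|).isEmpty) = !(p = q)`. [folklore] -/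
theorem mismatch_or_drop : ∀ p q : List Bool,
    (mismatch p q || !(q.drop p.length).isEmpty) = !decide (p = q)
  | [], q => by cases q <;> simp [mismatch]
  | d :: p, [] => by simp [mismatch]
  | d :: p, d' :: q => by
    have ih := mismatch_or_drop p q
    simp only [mismatch, List.length_cons, List.drop_succ_cons, List.cons.injEq, Bool.or_assoc]
    rw [ih]
    cases d <;> cases d' <;> by_cases h : p = q <;> simp [h]

/-- `eqChk a b g`: pop `a` and `b` in lockstep, setting the flag `g` at the first disagreement
(in symbol or in length); both registers end empty. [folklore] -/
def eqChk (a b g : ι) : Com ι :=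
  loop a (pop b skip (markBad g) (markBad g)) (pop b (markBad g) skip (markBad g)) ;;
  loop b (markBad g) (markBad g)

/-- The trailing loop of `eqChk`: empty `b`, setting the flag iff `b` was nonempty
(cost `≤ 6|q| + 1`). [folklore] -/
theorem runs_eqChk_tail {b g : ι} (hbg : b ≠ g) :
    ∀ (q : List Bool) (R : Regs ι) (c : Bool), R b = q → R g = flag c →
      Runs (loop b (markBad g) (markBad g)) R
        (Function.update (Function.update R b []) g (flag (c || !q.isEmpty))) (6 * q.length + 1)
  | [], R, c, hq, hg => by
    refine (Runs.loop_nil _ _ hq).of_eq ?_ (by simp)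
    ext i : 1
    simp only [Function.update_apply]
    split_ifs <;> simp_all
  | d :: q, R, c, hq, hg => by
    set R₁ := Function.update (Function.update R b q) g [true] with hR₁
    have hbody : Runs (markBad g) (Function.update R b q) R₁ 4 :=
      (runs_markBad_flag _ c (by rw [Function.update_of_ne hbg.symm, hg])).of_eq
        (by simp [hR₁]) le_rfl
    have ih := runs_eqChk_tail hbg q R₁ true (by simp [hR₁, Function.update_of_ne hbg])
      (by simp [hR₁])
    have e : Function.update (Function.update R₁ b []) g (flag (true || !q.isEmpty)) =
        Function.update (Function.update R b []) g (flag (c || !(d :: q).isEmpty)) := by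
      ext i : 1
      simp only [hR₁, Function.update_apply, List.isEmpty_cons, Bool.not_false, Bool.or_true,
        Bool.true_or]
      split_ifs <;> simp_all
    cases d
    · exact (Runs.loop_false (w := q) hq hbody ih).of_eq e (by simp; omega)
    · exact (Runs.loop_true (w := q) hq hbody ih).of_eq e (by simp; omega)

/-- The main loop of `eqChk` on `a = p`, `b = q`, a flag `g ∈ {ε, [true]}` (cost `≤ 8|p| + 1`):
`a` emptied, `b := q.drop |p|`, `g := flag (c || mismatch p q)`. [folklore] -/
theorem runs_eqChk_main {a b g : ι} (hab : a ≠ b) (hag : a ≠ g) (hbg : b ≠ g) :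
    ∀ (p q : List Bool) (R : Regs ι) (c : Bool), R a = p → R b = q → R g = flag c →
      Runs (loop a (pop b skip (markBad g) (markBad g)) (pop b (markBad g) skip (markBad g))) R
        (Function.update (Function.update (Function.update R a []) b (q.drop p.length)) g
          (flag (c || mismatch p q))) (8 * p.length + 1)
  | [], q, R, c, hp, hq, hg => by
    refine (Runs.loop_nil _ _ hp).of_eq ?_ (by simp)
    ext i : 1
    simp only [Function.update_apply, List.length_nil, List.drop_zero, mismatch, Bool.or_false]
    split_ifs <;> simp_all
  | d :: p, q, R, c, hp, hq, hg => by
    cases q with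
    | nil =>
      -- `b` is exhausted: flag
      set R₁ := Function.update (Function.update R a p) g [true] with hR₁
      have hbody : ∀ (ct cf : Com ι), Runs (pop b ct cf (markBad g)) (Function.update R a p) R₁
          (4 + 2) := fun ct cf =>
        Runs.pop_nil _ _ (by rw [Function.update_of_ne hab.symm, hq])
          ((runs_markBad_flag _ c (by rw [Function.update_of_ne hag.symm, hg])).of_eq
            (by simp [hR₁]) le_rfl)
      have ih := runs_eqChk_main hab hag hbg p [] R₁ true
        (by simp [hR₁, Function.update_of_ne hag]) (by simp [hR₁, Function.update_of_ne hbg,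
          Function.update_of_ne hab.symm, hq]) (by simp [hR₁])
      have e : Function.update (Function.update (Function.update R₁ a []) b
            (([] : List Bool).drop p.length)) g (flag (true || mismatch p [])) =
          Function.update (Function.update (Function.update R a []) b
            (([] : List Bool).drop (d :: p).length)) g (flag (c || mismatch (d :: p) [])) := by
        ext i : 1
        simp only [hR₁, Function.update_apply, List.drop_nil, mismatch, Bool.true_or,
          Bool.or_true]
        split_ifs <;> simp_all
      cases d
      · exact (Runs.loop_false (w := p) hp (hbody _ _) ih).of_eq e (by simp; omega)
      · exact (Runs.loop_true (w := p) hp (hbody _ _) ih).of_eq e (by simp; omega)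
    | cons d' q =>
      -- compare `d` with `d'`
      set c' : Bool := c || !decide (d = d') with hc'
      set R₁ := Function.update (Function.update (Function.update R a p) b q) g (flag c') with hR₁
      have hbq : Function.update R a p b = d' :: q := by rw [Function.update_of_ne hab.symm, hq]
      have hgq : Function.update (Function.update R a p) b q g = flag c := by
        rw [Function.update_of_ne hbg.symm, Function.update_of_ne hag.symm, hg]
      have eskip : d = d' → Function.update (Function.update R a p) b q = R₁ := by
        intro hdd
        ext i : 1
        simp only [hR₁, hc', Function.update_apply]
        split_ifs <;> simp_all
      have ebad : d ≠ d' → Function.update (Function.update (Function.update R a p) b q) g [true] =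
          R₁ := by
        intro hdd
        simp [hR₁, hc', hdd]
      have hbody : Runs (bif d then pop b skip (markBad g) (markBad g)
          else pop b (markBad g) skip (markBad g)) (Function.update R a p) R₁ (4 + 2) := by
        cases d <;> cases d' <;> simp only [cond_true, cond_false]
        · exact Runs.pop_false _ _ (w := q) hbq (((Runs.skip _).of_eq (eskip rfl) (by omega)))
        · exact Runs.pop_true _ _ (w := q) hbq ((runs_markBad_flag _ c hgq).of_eq
            (ebad (by decide)) le_rfl)
        · exact Runs.pop_false _ _ (w := q) hbq ((runs_markBad_flag _ c hgq).of_eq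
            (ebad (by decide)) le_rfl)
        · exact Runs.pop_true _ _ (w := q) hbq (((Runs.skip _).of_eq (eskip rfl) (by omega)))
      have ih := runs_eqChk_main hab hag hbg p q R₁ c'
        (by simp [hR₁, Function.update_of_ne hag, Function.update_of_ne hab])
        (by simp [hR₁, Function.update_of_ne hbg]) (by simp [hR₁])
      have e : Function.update (Function.update (Function.update R₁ a []) b (q.drop p.length)) g
            (flag (c' || mismatch p q)) =
          Function.update (Function.update (Function.update R a []) b
            ((d' :: q).drop (d :: p).length)) g (flag (c || mismatch (d :: p) (d' :: q))) := by
        ext i : 1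
        simp only [hR₁, hc', Function.update_apply, List.drop_succ_cons, List.length_cons,
          mismatch, Bool.or_assoc]
        split_ifs <;> simp_all
      cases d
      · exact (Runs.loop_false (w := p) hp hbody ih).of_eq e (by simp; omega)
      · exact (Runs.loop_true (w := p) hp hbody ih).of_eq e (by simp; omega)

/-- **Effect of the equality test** on `a = p`, `b = q`, a flag `g ∈ {ε, [true]}`
(cost `≤ 8|p| + 6|q| + 2`): `a`, `b` emptied and `g = [true]` iff it was or `p ≠ q`.
[folklore] -/
theorem runs_eqChk {a b g : ι} (hab : a ≠ b) (hag : a ≠ g) (hbg : b ≠ g) (p q : List Bool)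
    (R : Regs ι) (c : Bool) (hp : R a = p) (hq : R b = q) (hg : R g = flag c) :
    Runs (eqChk a b g) R
      (Function.update (Function.update (Function.update R a []) b []) g
        (flag (c || !decide (p = q)))) (8 * p.length + 6 * q.length + 2) := by
  have h1 := runs_eqChk_main hab hag hbg p q R c hp hq hg
  set c₁ : Bool := c || mismatch p q with hc₁
  set R₁ := Function.update (Function.update (Function.update R a []) b (q.drop p.length)) g
    (flag c₁) with hR₁
  have h2 := runs_eqChk_tail hbg (q.drop p.length) R₁ c₁
    (by simp [hR₁, Function.update_of_ne hbg]) (by simp [hR₁])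
  refine (h1.seq h2).of_eq ?_ ?_
  · ext i : 1
    simp only [hR₁, hc₁, Function.update_apply, Bool.or_assoc, mismatch_or_drop]
    split_ifs <;> simp_all
  · have : (q.drop p.length).length ≤ q.length := by simp
    omega

end Generic

/-! ### Length bounds for the pair reader -/

/-- `|readRest z| + |(boolUnpair z).1| ≤ |z|`. [folklore] -/
theorem length_readRest_add_le (z : List Bool) :
    (readRest z).length + (boolUnpair z).1.length ≤ z.length := by
  have h := readSteps_add_le z
  have h1 := one_le_readSteps z
  omega

end Com

/-- `|encodeNat n| ≤ n`. [folklore] -/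
private theorem length_encodeNat_le_self' (n : ℕ) : (encodeNat n).length ≤ n := by
  induction n using Nat.strong_induction_on with
  | _ n ih =>
    rcases Nat.eq_zero_or_pos n with rfl | hn
    · simp [encodeNat, encodeNum]
    · rw [encodeNat_eq_cons_div_two hn.ne', List.length_cons]
      have := ih (n / 2) (Nat.div_lt_self hn one_lt_two)
      omega

/-! ### The tagging program: `z ↦ ⟨1^{|fst z|}, z⟩` -/

namespace PadLin

open Com AReg

/-- Duplicate `s` (read reversed) onto `x` and `y`. [folklore] -/
def dupLoop : Com AReg := loop .s (push .x true ;; push .y true) (push .x false ;; push .y false)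

/-- Effect of `dupLoop` (cost `≤ 4|sv| + 1`): `x := sv.reverse ++ x`, `y := sv.reverse ++ y`,
`s` emptied. [folklore] -/
theorem runs_dupLoop : ∀ (sv xa ya zv tv uv fv gv : List Bool),
    Runs dupLoop (file xa ya zv sv tv uv fv gv) (file (sv.reverse ++ xa) (sv.reverse ++ ya) zv [] tv uv fv gv)
      (4 * sv.length + 1)
  | [], xa, ya, zv, tv, uv, fv, gv => (Runs.loop_nil _ _ (by simp)).of_eq (by simp) (by simp)
  | c :: sv, xa, ya, zv, tv, uv, fv, gv => by
    have ih := runs_dupLoop sv (c :: xa) (c :: ya) zv tv uv fv gv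
    have hbody : ∀ c : Bool, Runs (push AReg.x c ;; push AReg.y c) (file xa ya zv sv tv uv fv gv)
        (file (c :: xa) (c :: ya) zv sv tv uv fv gv) (1 + 1) := fun c =>
      ((Runs.push AReg.x c _).seq (Runs.push AReg.y c _)).of_eq (by simp) le_rfl
    cases c
    · refine (Runs.loop_false (w := sv) (by simp) (by simpa using hbody false) ih).of_eq ?_ ?_
      · simp
      · simp; omega
    · refine (Runs.loop_true (w := sv) (by simp) (by simpa using hbody true) ih).of_eq ?_ ?_
      · simp
      · simp; omega

/-- Two units on `x` per symbol of `z`. [folklore] -/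
def dblLoop : Com AReg := loop .z (push .x true ;; push .x true) (push .x true ;; push .x true)

/-- Effect of `dblLoop` (cost `≤ 4|zv| + 1`): `x := 1^{2|zv|} ++ x`, `z` emptied. [folklore] -/
theorem runs_dblLoop : ∀ (zv xa ya sv tv uv fv gv : List Bool),
    Runs dblLoop (file xa ya zv sv tv uv fv gv)
      (file (List.replicate (2 * zv.length) true ++ xa) ya [] sv tv uv fv gv) (4 * zv.length + 1)
  | [], xa, ya, sv, tv, uv, fv, gv => (Runs.loop_nil _ _ (by simp)).of_eq (by simp) (by simp)
  | c :: zv, xa, ya, sv, tv, uv, fv, gv => by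
    have ih := runs_dblLoop zv (true :: true :: xa) ya sv tv uv fv gv
    have hbody : Runs (push AReg.x true ;; push AReg.x true) (file xa ya zv sv tv uv fv gv)
        (file (true :: true :: xa) ya zv sv tv uv fv gv) (1 + 1) :=
      ((Runs.push AReg.x true _).seq (Runs.push AReg.x true _)).of_eq (by simp) le_rfl
    have e : file (List.replicate (2 * zv.length) true ++ true :: true :: xa) ya [] sv tv uv fv gv =
        file (List.replicate (2 * (c :: zv).length) true ++ xa) ya [] sv tv uv fv gv := by
      simp only [List.length_cons, Nat.mul_succ, List.replicate_succ', List.append_assoc,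
        List.singleton_append]
      rfl
    cases c
    · exact (Runs.loop_false (w := zv) (by simp) (by simpa using hbody) ih).of_eq e (by simp; omega)
    · exact (Runs.loop_true (w := zv) (by simp) (by simpa using hbody) ih).of_eq e (by simp; omega)

/-- **The tagging program**: from `z` on `x` to `⟨1^{|(boolUnpair z).1|}, z⟩` on `x` — copy
`z`, read the first component of the copy (`prs`), emit the separator and two units per bit
read. [folklore] -/
def tagProg : Com AReg :=
  pour .x .s ;; dupLoop ;; prs .y .z .t ;; clear .t ;; push .x true ;; push .x false ;; dblLoop

/-- Doubling units: `⟨1ᵏ, z⟩ = 1^{2k} 0 1 z` (cf. `boolPair_replicate_true` of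
`CookLevinReduction.lean`; a local copy keeps this brick's imports small). [folklore] -/
private theorem boolPair_replicate_true (k : ℕ) (z : List Bool) :
    boolPair (List.replicate k true) z = List.replicate (2 * k) true ++ false :: true :: z := by
  induction k with
  | zero => simp [boolPair]
  | succ k ih =>
    simp only [boolPair, List.append_assoc, List.cons_append, List.nil_append] at ih
    simp only [boolPair, List.replicate_succ, List.flatMap_cons, List.cons_append, List.nil_append,
      List.append_assoc, ih, Nat.mul_succ]

/-- **Effect of the tagging program** (cost `≤ 16|z| + 10`): from `z` on `x`, all else empty, to
`boolPair 1^{|(boolUnpair z).1|} z` on `x`, all else empty. [folklore] -/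
theorem runs_tagProg (z : List Bool) :
    Runs tagProg (file z [] [] [] [] [] [] [])
      (file (boolPair (List.replicate (boolUnpair z).1.length true) z) [] [] [] [] [] [] [])
      (16 * z.length + 10) := by
  have h1 := runs_pour (a := AReg.x) (b := AReg.s) (by decide) (file z [] [] [] [] [] [] [])
  simp only [file_x, file_s, List.append_nil, update_file_x, update_file_s] at h1
  have h2 := runs_dupLoop z.reverse [] [] [] [] [] [] []
  simp only [List.reverse_reverse, List.append_nil, List.length_reverse] at h2
  have h3 := runs_prs (src := AReg.y) (dst := AReg.z) (tmp := AReg.t) (by decide) (by decide)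
    (by decide) z (file z z [] [] [] [] [] []) (by simp) (by simp)
  simp only [file_z, List.append_nil, update_file_y, update_file_z, update_file_t] at h3
  have h4 := runs_clear AReg.t (file z [] (boolUnpair z).1.reverse [] (readRest z).reverse [] [] [])
  simp only [file_t, List.length_reverse, update_file_t] at h4
  have h5a : Runs (push AReg.x true) (file z [] (boolUnpair z).1.reverse [] [] [] [] [])
      (file (true :: z) [] (boolUnpair z).1.reverse [] [] [] [] []) 1 :=
    (Runs.push AReg.x true _).of_eq (by simp) le_rfl
  have h5b : Runs (push AReg.x false) (file (true :: z) [] (boolUnpair z).1.reverse [] [] [] [] [])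
      (file (false :: true :: z) [] (boolUnpair z).1.reverse [] [] [] [] []) 1 :=
    (Runs.push AReg.x false _).of_eq (by simp) le_rfl
  have h6 := runs_dblLoop (boolUnpair z).1.reverse (false :: true :: z) [] [] [] [] [] []
  simp only [List.length_reverse] at h6
  have hl := Com.length_readRest_add_le z
  refine (h1.seq (h2.seq (h3.seq (h4.seq (h5a.seq (h5b.seq h6)))))).of_eq ?_ ?_
  · rw [boolPair_replicate_true]
  · omega

/-- **The tagging machine**: `z ↦ ⟨1^{|(boolUnpair z).1|}, z⟩` within `16|z| + 11` steps.
[folklore] -/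
theorem exists_tag_machine : ∃ T : TM2ComputableAux Bool Bool, ∀ z : List Bool,
    T.OutputsWithin z (boolPair (List.replicate (boolUnpair z).1.length true) z) (16 * z.length + 11) := by
  refine ⟨(compile (tagProg.map (Fintype.equivFin AReg))).toAux (Fintype.equivFin AReg .x)
    (Fintype.equivFin AReg .x), fun z => ?_⟩
  have h := runs_tagProg z
  rw [← Com.init_x_eq_file, ← Com.init_x_eq_file] at h
  exact Com.outputsWithin_of_runs_equiv (Fintype.equivFin AReg) (Or.inl h)

/-! ### The un-padding program -/

/-- The core of the un-padding, on a word `w` read as `⟨B, z⟩` with `z` read as `⟨x, u⟩`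
(`B = (boolUnpair w).1`, `z = readRest w`, `x = (boolUnpair z).1`, `u = readRest z`): the payload
`x` if `u` consists of units and `|u|` is the number coded by `B`, else `ε`. [folklore] -/
def unpadCore (w : List Bool) : List Bool :=
  if (readRest (readRest w)).all id = true ∧
      encodeNat (readRest (readRest w)).length = (boolUnpair w).1
  then (boolUnpair (readRest w)).1 else []

/-- **The un-padding program** (registers `AReg`, input on `x`, output on `s`): read `B`
(reversed) onto `y` and recover `z`; read `x` (reversed) onto `z` and `u` (reversed) onto `t`;
move `u` as units onto `x`, flagging a non-unit (`onesChk`); count the units in binary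
(`LinClock.binLoop`, digits reversed on `t`); compare with `B` (`eqChk`, flag `g`); keep or drop
the payload according to the flag and pour it, in order, onto `s`. [folklore] -/
def unpadProg : Com AReg :=
  prs .x .y .t ;; pour .t .x ;; prs .x .z .t ;; onesChk .t .x .g ;; LinClock.binLoop ;;
  eqChk .t .y .g ;; pop .g (clear .z) skip skip ;; pour .z .s

/-- `setTrue`-style flags on `g` read by `pop`: keep or clear `z` (cost `≤ 2|z| + 3`).
[folklore] -/
theorem runs_keepOrDrop (zv : List Bool) (c : Bool) :
    Runs (pop AReg.g (clear .z) skip skip) (file [] [] zv [] [] [] [] (flag c))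
      (file [] [] (bif c then [] else zv) [] [] [] [] []) (2 * zv.length + 1 + 2) := by
  cases c
  · exact (Runs.pop_nil _ _ (by simp) ((Runs.skip _).of_eq (by simp) (Nat.zero_le _)))
  · refine Runs.pop_true _ _ (w := []) (by simp) ((runs_clear AReg.z _).of_eq ?_ ?_)
    · funext r; cases r <;> simp
    · simp

/-- **Effect of the un-padding program** (cost `≤ 59|w| + 20`): from `w` on `x`, all else
empty, to `unpadCore w` on `s`, all else empty. [folklore] -/
theorem runs_unpadProg (w : List Bool) :
    Runs unpadProg (file w [] [] [] [] [] [] []) (file [] [] [] (unpadCore w) [] [] [] [])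
      (59 * w.length + 20) := by
  -- names for the components
  set B := (boolUnpair w).1 with hB
  set z := readRest w with hz
  set xp := (boolUnpair z).1 with hxp
  set u := readRest z with hu
  have hlw := Com.length_readRest_add_le w
  have hlz := Com.length_readRest_add_le z
  rw [← hB, ← hz] at hlw
  rw [← hxp, ← hu] at hlz
  -- 1. read `B`, set `z` aside
  have h1 := runs_prs (src := AReg.x) (dst := AReg.y) (tmp := AReg.t) (by decide) (by decide)
    (by decide) w (file w [] [] [] [] [] [] []) (by simp) (by simp)
  simp only [file_y, List.append_nil, update_file_x, update_file_y, update_file_t, ← hB, ← hz] at h1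
  -- 2. recover `z` in order
  have h2 := runs_pour (a := AReg.t) (b := AReg.x) (by decide) (file [] B.reverse [] [] z.reverse [] [] [])
  simp only [file_t, file_x, List.reverse_reverse, List.append_nil, List.length_reverse,
    update_file_t, update_file_x] at h2
  -- 3. read `x`, set `u` aside
  have h3 := runs_prs (src := AReg.x) (dst := AReg.z) (tmp := AReg.t) (by decide) (by decide)
    (by decide) z (file z B.reverse [] [] [] [] [] []) (by simp) (by simp)
  simp only [file_z, List.append_nil, update_file_x, update_file_z, update_file_t, ← hxp, ← hu]
    at h3
  -- 4. units of `u` onto `x`, flag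
  have h4 := runs_onesChk (src := AReg.t) (dst := AReg.x) (g := AReg.g) (by decide) (by decide)
    (by decide) u.reverse (file [] B.reverse xp.reverse [] u.reverse [] [] []) false (by simp)
    (by simp)
  simp only [file_x, List.append_nil, List.length_reverse, update_file_t, update_file_x,
    update_file_g, Bool.false_or, List.all_reverse] at h4
  set bad : Bool := !(u.all id) with hbad
  -- 5. count the units
  have h5 := LinClock.runs_binLoop u.length [] B.reverse xp.reverse [] (flag bad)
  simp only [List.append_nil] at h5
  -- 6. compare with `B`
  have h6 := runs_eqChk (a := AReg.t) (b := AReg.y) (g := AReg.g) (by decide) (by decide) (by decide)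
    (encodeNat u.length).reverse B.reverse (file [] B.reverse xp.reverse [] (encodeNat u.length).reverse
      [] [] (flag bad)) bad (by simp) (by simp) (by simp)
  simp only [update_file_t, update_file_y, update_file_g, List.length_reverse,
    List.reverse_inj] at h6
  set bad' : Bool := bad || !decide (encodeNat u.length = B) with hbad'
  -- 7. keep or drop, 8. pour
  have h7 := runs_keepOrDrop xp.reverse bad'
  rw [List.length_reverse] at h7
  have h8 := runs_pour (a := AReg.z) (b := AReg.s) (by decide)
    (file [] [] (bif bad' then [] else xp.reverse) [] [] [] [] [])
  simp only [file_z, file_s, List.append_nil, update_file_z, update_file_s] at h8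
  have hlen8 : (bif bad' then ([] : List Bool) else xp.reverse).length ≤ xp.length := by
    cases bad' <;> simp
  have hlenB : (encodeNat u.length).length ≤ u.length := length_encodeNat_le_self' u.length
  refine (h1.seq (h2.seq (h3.seq (h4.seq (h5.seq (h6.seq (h7.seq h8))))))).of_eq ?_ ?_
  · simp only [unpadCore, ← hz, ← hu, ← hB, ← hxp, hbad', hbad]
    by_cases hall : u.all id = true
    · by_cases heq : encodeNat u.length = B
      · simp [hall, heq]
      · simp [hall, heq]
    · simp [hall]
  · omega

/-- `Regs.init .s` on the bank. [folklore] -/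
theorem init_s_eq_file (w : List Bool) : Regs.init AReg.s w = file [] [] [] w [] [] [] [] := by
  funext r; cases r <;> rfl

/-- **The un-padding core machine**: `w ↦ unpadCore w` within `59|w| + 21` steps. [folklore] -/
theorem exists_unpadCore_machine : ∃ U : TM2ComputableAux Bool Bool, ∀ w : List Bool,
    U.OutputsWithin w (unpadCore w) (59 * w.length + 21) := by
  refine ⟨(compile (unpadProg.map (Fintype.equivFin AReg))).toAux (Fintype.equivFin AReg .x)
    (Fintype.equivFin AReg .s), fun w => ?_⟩
  have h := runs_unpadProg w
  rw [← Com.init_x_eq_file, ← init_s_eq_file] at h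
  exact Com.outputsWithin_of_runs_equiv (Fintype.equivFin AReg) (Or.inl h)

end PadLin

/-! ### The linear padding: `unpadLin`, `padLin` -/

/-- **The un-padding function at level `g`**: a word `z` read as `⟨x, u⟩` (`x = (boolUnpair z).1`,
`u = readRest z`) is a VALID pad iff `u = 1^{g|x|}`; valid pads are sent to their payload `x`,
every other word to `ε` (the convention of `polyUnpad`, `NTIMEPadding.lean`). [folklore] -/
def unpadLin (g : ℕ → ℕ) (z : List Bool) : List Bool :=
  if readRest z = List.replicate (g (boolUnpair z).1.length) true then (boolUnpair z).1 else []

/-- The canonical pad `⟨x, 1^{g|x|}⟩` un-pads to `x`. [folklore] -/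
@[simp] theorem unpadLin_pad (g : ℕ → ℕ) (x : List Bool) :
    unpadLin g (boolPair x (List.replicate (g x.length) true)) = x := by
  simp [unpadLin]

/-- `|unpadLin g z| ≤ |z|`. [folklore] -/
theorem length_unpadLin_le (g : ℕ → ℕ) (z : List Bool) : (unpadLin g z).length ≤ z.length := by
  have := Com.length_readRest_add_le z
  unfold unpadLin
  split_ifs
  · omega
  · simp

/-- The level of an un-padded word is paid for by the word: `g |unpadLin g z| ≤ |z| + g 0`
(valid: `g|x| = |u| ≤ |z|`; invalid: `x = ε`). [folklore] -/
theorem apply_length_unpadLin_le (g : ℕ → ℕ) (z : List Bool) :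
    g (unpadLin g z).length ≤ z.length + g 0 := by
  have hl := Com.length_readRest_add_le z
  unfold unpadLin
  split_ifs with h
  · have := congrArg List.length h
    rw [List.length_replicate] at this
    omega
  · simp

/-- A word of units of prescribed length: `u.all id ∧ |u| = m ↔ u = 1ᵐ`. [folklore] -/
theorem all_and_length_iff_eq_replicate (u : List Bool) (m : ℕ) :
    (u.all id = true ∧ u.length = m) ↔ u = List.replicate m true := by
  constructor
  · rintro ⟨h1, h2⟩
    subst h2
    refine List.eq_replicate_iff.2 ⟨rfl, fun b hb => ?_⟩
    have := List.all_eq_true.1 h1 b hb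
    simpa using this
  · rintro rfl
    simp

/-- Mathlib's numerals are injective (local copy of `encodeNat_injective`). [folklore] -/
private theorem encodeNat_injective' {a b : ℕ} (h : encodeNat a = encodeNat b) : a = b := by
  simpa using congrArg bitsToNat h

/-- **The core un-pads the tagged word**: on `⟨bin (g |x|), z⟩` the core computes `unpadLin g z`.
[folklore] -/
theorem unpadCore_tagged (g : ℕ → ℕ) (z : List Bool) :
    PadLin.unpadCore (boolPair (encodeNat (g (boolUnpair z).1.length)) z) = unpadLin g z := by
  simp only [PadLin.unpadCore, readRest_boolPair, boolUnpair_boolPair, unpadLin]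
  by_cases h : readRest z = List.replicate (g (boolUnpair z).1.length) true
  · rw [if_pos h, if_pos]
    refine ⟨by rw [h]; simp, by rw [h, List.length_replicate]⟩
  · rw [if_neg h, if_neg]
    rintro ⟨h1, h2⟩
    exact h ((all_and_length_iff_eq_replicate _ _).1 ⟨h1, encodeNat_injective' h2⟩)

/-- **The padded language at level `g`**: `padLin g L = (unpadLin g)⁻¹(L)`, i.e. the canonical
pads `⟨x, 1^{g|x|}⟩` of the members `x ∈ L`, together with every invalid word iff `ε ∈ L`
(Arora–Barak 2009, §2.6.2: `L_pad = {⟨x, 1^{…}⟩ : x ∈ L}`). [cite: AroraBarakCC2009, §2.6.2 (padding)] -/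
def padLin (g : ℕ → ℕ) (L : Language Bool) : Language Bool :=
  {z | unpadLin g z ∈ L}

/-- Membership in the padded language (definitional). [folklore] -/
@[simp] theorem mem_padLin {g : ℕ → ℕ} {L : Language Bool} {z : List Bool} :
    z ∈ padLin g L ↔ unpadLin g z ∈ L :=
  Iff.rfl

/-- The canonical pad of `x` is in `padLin g L` iff `x ∈ L`. [folklore] -/
theorem pad_mem_padLin {g : ℕ → ℕ} {L : Language Bool} {x : List Bool} :
    boolPair x (List.replicate (g x.length) true) ∈ padLin g L ↔ x ∈ L := by
  simp

/-! ### Bounds that are linear-time computable in binary -/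

/-- **A bound computable in binary in LINEAR time is time constructible** (`g n ≥ n`; the
tree's `IsTimeConstructible` only asks for time `O(g n)`). [cite: AroraBarakCC2009, §1.3 (p. 16)] -/
theorem isTimeConstructible_of_linear_binary {g : ℕ → ℕ} {c : ℕ}
    (hG : TimeComputable unaryEncodeNat encodeNat g fun n => c * n + c) (hid : ∀ n, n ≤ g n) :
    IsTimeConstructible g :=
  ⟨hid, c, hG.mono fun n => Nat.add_le_add_right (Nat.mul_le_mul_left c (hid n)) c⟩

/-! ### The un-padding machine -/

/-- Bookkeeping for the un-padding machine's running time. [folklore] -/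
private theorem unpad_arith (c D k n B : ℕ) (hk : k ≤ n) (hB : B ≤ k + D * (c * k + c)) :
    16 * n + 11 + (c * k + c + 3 * B + 2 * (2 * k + 2 + n) + 6) + (59 * (2 * B + 2 + n) + 21) ≤
      400 * (1 + c) * (1 + D) * n + 400 * (1 + c) * (1 + D) := by
  have h1 : D * (c * k) ≤ D * (c * n) := Nat.mul_le_mul_left _ (Nat.mul_le_mul_left _ hk)
  have h2 : c * k ≤ c * n := Nat.mul_le_mul_left _ hk
  nlinarith [h1, h2, hk, hB, Nat.zero_le (D * (c * n)), Nat.zero_le (c * n), Nat.zero_le (D * c),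
    Nat.zero_le (D * n), Nat.zero_le D, Nat.zero_le c]

/-- **The un-padding machine**: if `1ⁿ ↦ bin (g n)` runs in linear time, some `TM2` machine maps
every `z` to `unpadLin g z` in linear time — tag `z` with `1^{|x|}` (`PadLin.exists_tag_machine`),
compute `bin (g|x|)` on the tag while `z` is parked (`mapFstAux`, `MapFstMachine.lean`), then run
the core (`PadLin.exists_unpadCore_machine`): validity of a pad is decided by comparing the
NUMERALS `bin |u|` and `bin (g|x|)`, never by producing `1^{g|x|}`, so invalid words with a short
`u` cost no more than their length. [folklore] -/
theorem exists_unpadLin_machine {g : ℕ → ℕ} {c : ℕ}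
    (hG : TimeComputable unaryEncodeNat encodeNat g fun n => c * n + c) :
    ∃ (U : TM2ComputableAux Bool Bool) (e : ℕ), ∀ z : List Bool,
      U.OutputsWithin z (unpadLin g z) (e * z.length + e) := by
  obtain ⟨G, hG⟩ := hG
  obtain ⟨T, hT⟩ := PadLin.exists_tag_machine
  obtain ⟨U, hU⟩ := PadLin.exists_unpadCore_machine
  set D := TM2Comp.machinePushBound G.tm with hD
  refine ⟨T.comp ((mapFstAux G).comp U), 400 * (1 + c) * (1 + D), fun z => ?_⟩
  set k := (boolUnpair z).1.length with hk
  have hkz : k ≤ z.length := by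
    have := Com.length_readRest_add_le z
    omega
  -- the binary clock on the tag
  have hGk : G.OutputsWithin (List.replicate k true) (encodeNat (g k)) (c * k + c) := by
    have := hG k
    dsimp only at this
    rwa [unaryEncodeNat_eq_replicate, List.length_replicate] at this
  have hB : (encodeNat (g k)).length ≤ k + D * (c * k + c) := by
    have := TM2Comp.length_le_of_outputsWithin G hGk
    rwa [List.length_replicate] at this
  -- stage 1: tag
  have h₁ := hT z
  -- stage 2: numeral of the level, `z` parked
  have h₂ : (mapFstAux G).OutputsWithin (boolPair (List.replicate k true) z)
      (boolPair (encodeNat (g k)) z) (c * k + c + 3 * (encodeNat (g k)).length +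
        2 * (boolPair (List.replicate k true) z).length + 6) := by
    have := outputsWithin_mapFstAux G (z := boolPair (List.replicate k true) z)
      (out := encodeNat (g k)) (m := c * k + c) (by simpa using hGk)
    simpa only [readRest_boolPair] using this
  -- stage 3: the core
  have h₃ : U.OutputsWithin (boolPair (encodeNat (g k)) z) (unpadLin g z)
      (59 * (boolPair (encodeNat (g k)) z).length + 21) := by
    have := hU (boolPair (encodeNat (g k)) z)
    rwa [unpadCore_tagged] at this
  have h₂₃ := Turing.TM2ComputableAux.comp_outputsWithin _ _ h₂ h₃
  have h := Turing.TM2ComputableAux.comp_outputsWithin _ _ h₁ h₂₃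
  refine h.mono ?_
  simp only [length_boolPair, List.length_replicate]
  have := unpad_arith c D k z.length _ hkz hB
  omega

/-- **Un-pad, then the witness clock**: for `1 ≤ cV` some machine maps every `z` to
`⟨x', 1^{cV · g|x'| + cV}⟩`, `x' = unpadLin g z`, in linear time (the level of `x'` is paid for
by `z`, `apply_length_unpadLin_le`). [folklore] -/
theorem exists_unpad_clock_machine {g : ℕ → ℕ} {c : ℕ}
    (hG : TimeComputable unaryEncodeNat encodeNat g fun n => c * n + c) (hid : ∀ n, n ≤ g n)
    {cV : ℕ} (hcV : 1 ≤ cV) :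
    ∃ (N : TM2ComputableAux Bool Bool) (e : ℕ), ∀ z : List Bool,
      N.OutputsWithin z (boolPair (unpadLin g z)
        (List.replicate (cV * g (unpadLin g z).length + cV) true)) (e * z.length + e) := by
  obtain ⟨U, e₁, hU⟩ := exists_unpadLin_machine hG
  obtain ⟨N, a, hN⟩ := exists_unaryClock_of_timeConstructible
    ((isTimeConstructible_of_linear_binary hG hid).mul_add hcV)
  refine ⟨U.comp N, e₁ + a * cV * (g 0 + 2) + a, fun z => ?_⟩
  have h₁ := hU z
  have h₂ := hN (unpadLin g z)
  have h := Turing.TM2ComputableAux.comp_outputsWithin _ _ h₁ h₂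
  refine h.mono ?_
  have hl := apply_length_unpadLin_le g z
  have : a * (cV * g (unpadLin g z).length + cV) ≤ a * (cV * (z.length + g 0) + cV) :=
    Nat.mul_le_mul_left a (Nat.add_le_add_right (Nat.mul_le_mul_left cV hl) cV)
  nlinarith [this, Nat.zero_le (a * cV), Nat.zero_le (a * cV * z.length)]

/-! ### The padded language of an `NTIME(g)` language is in `NTIME(n)` -/

/-- **Downward translation of the verifier.** If `1ⁿ ↦ bin (g n)` runs in linear time and
`g n ≥ n`, then for `L ∈ NTIME(g)` the padded language `padLin g L` is in `NTIME(n)`, in the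
tree's one-constant verifier form: the verifier on `⟨z, y⟩` un-pads `z` to `x'` and CUTS `y` at
the admissible length `c · g|x'| + c` of the given verifier `V` (the truncating wrapper
`truncMapAux` over the un-pad-and-clock machine, reading the discarded part of `y` two symbols
per step), then runs `V` on `⟨x', y ↾ …⟩`; valid pads `⟨x, 1^{g|x|}⟩` are accepted with exactly
the witnesses of `x`, invalid words behave as pads of `ε` (Arora–Barak 2009, §2.6.2 / Thm. 2.22:
"padding"; Santhanam 2001, §2: the translation step of [24]).
[cite: AroraBarakCC2009, §2.6.2 and Thm. 2.6] [cite: Santhanam2001, §2 (p. 3)] -/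
theorem padLin_mem_NTIME_id {g : ℕ → ℕ} {c : ℕ}
    (hG : TimeComputable unaryEncodeNat encodeNat g fun n => c * n + c) (hid : ∀ n, n ≤ g n)
    {L : Language Bool} (hL : L ∈ NTIME g) : padLin g L ∈ NTIME (fun n => n) := by
  obtain ⟨V⟩ := mem_NTIME_iff_nonempty_nVerifier.1 hL
  rcases Nat.eq_zero_or_pos V.c with hc0 | hcV
  · have h0 := V.outputsWithin [] [] (by simp)
    rw [hc0] at h0
    exact (not_outputsWithin_zero V.machine _ _ (by simpa using h0)).elim
  obtain ⟨N, e, hN⟩ := exists_unpad_clock_machine hG hid (cV := V.c) hcV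
  -- the verifier, the window, the constant
  let W : List Bool → ℕ := fun z => V.c * g (unpadLin g z).length + V.c
  let M : TM2ComputableAux Bool Bool := (truncMapAux N).comp V.machine
  let K : ℕ := e + 6 * V.c * (g 0 + 1) + 14
  have hW : ∀ z, V.c * g (unpadLin g z).length + V.c ≤ V.c * z.length + V.c * g 0 + V.c :=
    fun z => by
    have := Nat.mul_le_mul_left V.c (apply_length_unpadLin_le g z)
    rw [Nat.mul_add] at this
    omega
  refine ⟨2 * K + 2, fun z y => V.rel (unpadLin g z) (y.take (W z)), M, fun z y hy => ?_,
    fun z => ?_⟩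
  · -- running time on an admissible pair
    dsimp only at hy
    have h₁ := outputsWithin_truncMapAux_boolPair N (y := y) (hN z)
    simp only [List.length_replicate] at h₁
    set x' := unpadLin g z with hx'
    set y' := y.take (W z) with hy'
    have hlen' : y'.length ≤ V.c * g x'.length + V.c := List.length_take_le _ _
    have h₂ : V.machine.OutputsWithin (boolPair x' y') (encodeBool (V.rel x' y'))
        (V.c * g x'.length + V.c) := V.outputsWithin x' y' hlen'
    have h := Turing.TM2ComputableAux.comp_outputsWithin _ _ h₁ h₂
    refine h.mono ?_
    have hxl : x'.length ≤ z.length := length_unpadLin_le g z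
    have hWz := hW z
    have hy2 : 2 * (y.length / 2) ≤ (2 * K + 2) * z.length + (2 * K + 2) :=
      (Nat.mul_div_le y.length 2).trans hy
    have eK : K = e + 6 * V.c * (g 0 + 1) + 14 := rfl
    have hW' : V.c * g x'.length + V.c ≤ V.c * z.length + V.c * g 0 + V.c := hWz
    have hK1 : e + 6 * V.c + 15 ≤ K + 1 := by
      have : 6 * V.c ≤ 6 * V.c * (g 0 + 1) := Nat.le_mul_of_pos_right _ (Nat.succ_pos _)
      omega
    have hK2 : 3 * (V.c * g 0) + 3 * V.c + e + 11 ≤ K + 1 := by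
      have : 6 * V.c * (g 0 + 1) = 6 * (V.c * g 0) + 6 * V.c := by ring
      omega
    have hz1 : (e + 6 * V.c + 15) * z.length ≤ (K + 1) * z.length := Nat.mul_le_mul_right _ hK1
    have expand : (e + 6 * V.c + 15) * z.length =
        e * z.length + 6 * (V.c * z.length) + 15 * z.length := by ring
    have expand2 : (2 * K + 2) * z.length = 2 * ((K + 1) * z.length) := by ring
    have hy' : y.length / 2 ≤ (K + 1) * z.length + (K + 1) := by omega
    show _ ≤ (2 * K + 2) * z.length + (2 * K + 2)
    omega
  · -- correctness
    rw [mem_padLin, V.mem_iff (unpadLin g z)]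
    constructor
    · rintro ⟨y₀, hy₀, hR⟩
      refine ⟨y₀, ?_, ?_⟩
      · have hWz := hW z
        have eK : K = e + 6 * V.c * (g 0 + 1) + 14 := rfl
        have hW' : V.c * g (unpadLin g z).length + V.c ≤ V.c * z.length + V.c * g 0 + V.c := hWz
        have hK2 : V.c * g 0 + V.c ≤ K + 1 := by
          have : 6 * V.c * (g 0 + 1) = 6 * (V.c * g 0) + 6 * V.c := by ring
          omega
        have hK3 : V.c * z.length ≤ (2 * K + 2) * z.length :=
          Nat.mul_le_mul_right _ (by omega)
        show y₀.length ≤ (2 * K + 2) * z.length + (2 * K + 2)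
        omega
      · show V.rel (unpadLin g z) (y₀.take (W z)) = true
        rwa [List.take_of_length_le hy₀]
    · rintro ⟨y, -, hR⟩
      exact ⟨y.take (W z), List.length_take_le _ _, hR⟩

/-! ### Back up: a linear-time decider of the padded language decides `L` in time `O(g)` -/

/-- The indicator of the padded language at a canonical pad. [folklore] -/
theorem boolIndicator_padLin_pad (g : ℕ → ℕ) (L : Language Bool) (x : List Bool) :
    (padLin g L).boolIndicator (boolPair x (List.replicate (g x.length) true)) =
      L.boolIndicator x := by
  have h1 : ∀ (s : Set (List Bool)) (w : List Bool), s.boolIndicator w = true ↔ w ∈ s :=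
    fun s w => (Set.mem_iff_boolIndicator s w).symm
  rw [Bool.eq_iff_iff, h1, h1]
  exact pad_mem_padLin

/-- **Upward translation of the decider.** If `g` is time constructible and `padLin g L` is
decidable in deterministic linear time, then `L ∈ DTIME(g)`: pad (the unary clock
`x ↦ ⟨x, 1^{g|x|}⟩`, `exists_unaryClock_of_timeConstructible`), then decide the pad, whose length
is `2|x| + 2 + g|x| ≤ 3 g|x| + 2` (Arora–Barak 2009, §2.6.2, proof of Thm. 2.22).
[cite: AroraBarakCC2009, §2.6.2 (proof of Thm. 2.22)] -/
theorem mem_DTIME_of_padLin_mem_DTIME_id {g : ℕ → ℕ} (hg : IsTimeConstructible g)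
    {L : Language Bool} (h : padLin g L ∈ DTIME (fun n => n)) : L ∈ DTIME g := by
  obtain ⟨a, hdec⟩ := h
  obtain ⟨M, hM⟩ := (hdec : TimeDecidable id (padLin g L) fun n => a * n + a)
  obtain ⟨N, b, hN⟩ := exists_unaryClock_of_timeConstructible hg
  refine ⟨b + 3 * a, N.comp M, fun x => ?_⟩
  have h₁ := hN x
  have h₂ := hM (boolPair x (List.replicate (g x.length) true))
  simp only [id, length_boolPair, List.length_replicate, boolIndicator_padLin_pad] at h₂
  have h := Turing.TM2ComputableAux.comp_outputsWithin _ _ h₁ h₂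
  simp only [id]
  refine h.mono ?_
  have := hg.1 x.length
  nlinarith [this]

/-! ### The translation lemma -/

/-- **PPST's translation step** (PPST 1983, §4; Santhanam 2001, §2, p. 3: "if
`DTIME(n) = NTIME(n)`, then `DTIME(t) = Σ₄(t)` for any time-constructible `t`" — here its
`NTIME` instance; Arora–Barak 2009, §2.6.2 "translating upward"): if `NTIME(n) ⊆ DTIME(n)` then
`NTIME(g) ⊆ DTIME(g)` for every bound `g ≥ id` whose binary value `bin (g n)` is computable from
`1ⁿ` in LINEAR time (as are `n ↦ n log* n`, `n log n`, the polynomials, `2ⁿ`; this is what makes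
the validity of a pad decidable in linear time). Proof: `L ∈ NTIME(g)` ⟹ `padLin g L ∈ NTIME(n)`
(`padLin_mem_NTIME_id`) `⊆ DTIME(n)` ⟹ `L ∈ DTIME(g)` (`mem_DTIME_of_padLin_mem_DTIME_id`).
[cite: Santhanam2001, §2 (p. 3)] [cite: AroraBarakCC2009, §2.6.2 and Thm. 2.22] -/
theorem NTIME_subset_DTIME_of_linear_collapse {g : ℕ → ℕ} {c : ℕ}
    (hG : TimeComputable unaryEncodeNat encodeNat g fun n => c * n + c) (hid : ∀ n, n ≤ g n)
    (h : NTIME (fun n => n) ⊆ DTIME (fun n => n)) : NTIME g ⊆ DTIME g := fun _ hL =>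
  mem_DTIME_of_padLin_mem_DTIME_id (isTimeConstructible_of_linear_binary hG hid)
    (h (padLin_mem_NTIME_id hG hid hL))

end Literature.Computability.Complexity
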